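import Summits.QuantumFields.YangMills.Theses.BalabanUVNodes
import Summits.QuantumFields.YangMills.Theorems.BalabanUVNodesN27AtAllPinsOfRecord13CoPHVCutBFreeBareLedgerReadingKernelFaces
import Summits.QuantumFields.YangMills.Theorems.BalabanUVNodesN20OffLiveOneTermReading
import Summits.QuantumFields.YangMills.Theorems.BalabanUVNodesN22AtRecordOfGenAnalyticNonexpansive
import Summits.QuantumFields.YangMills.Theorems.BalabanUVNodesN18KernelStepRateKingMechanismRecord
import Summits.QuantumFields.YangMills.Theorems.BalabanUVNodesN18AtRecordOfKernelLetters

/-!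
# ★★ LEAF AWBⱽ-1T-K-N22J63 (dag-n27-c g19) — LEAF AWBⱽ-1T-K (`…VBFreeBareLedgerReadingOneTermKernelFaces`) WITH THE N22 FACE PRODUCED BY dag-n22-c's ROAD 2 FROM A **NON-EXPANSIVE**
# ANALYTIC READING (module J63 `n22At_u3OfRecord₁₃_of_kernelStepRate_genAnalyticNonexpansive`, on J60 + J62): NO growth rate `ν` — N18's rate DECOUPLED from the recursion's constants AND THE N18 FACE BY NODE N18's LIMIT LETTER: node U3's displayed share = `hs hκ hcr hκ₀` ·
# the (D4)-type letter at every pair `hK` · N18's `KernelStepRateOfRecord₁₃ … κ₅ (ℓ F θ).θ₅ C₅` (`h5`) · (1.21) `hlim` · J63's rows on def-W1's generator towers `Gn` — NO N22 face ∕ letter row,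
# NO step schema, NO output-bound row, NO growth rate: a non-expansive weight table (`aw ≤ c_w`, `4M_b c_w∕ϱ < 1`) and the letter block's STANDING rows `θ₅ ≤ ω²`, `ℓ.κ ≤ δ₁ ≤ κ₅`.

Cell `pub-ymgap`, HUMAN RULING D-0062 Track A; R134 seat `pub-ymgap-dag-n27-c` (N27 B5 composite, s2), gen 19, trigger (t2⁗) «a NEW producer of a kernel FACE in the limit currency»:
dag-n22-c g18 J63 `…N22AtRecordOfGenAnalyticNonexpansive` ★★★ `YMDAG.N22.KernelFading.n22At_u3OfRecord₁₃_of_kernelStepRate_genAnalyticNonexpansive` (⊢ `∀ k, N22At (u3OfRecord₁₃ θ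
(objectsOfRecord₁₃ F N θ ℓ) k)` — this lane's `h22` binder); K3⁸ `SpineGivenEndpointR13SepCoPHV` = stmt-QuantumFields-27366 (skeleton v6 b4e55110ab73e679), `--kind proof --supports 27366
--as helper`; COUNT-NEUTRAL.  ONE theorem, 0 `def`, 0 `sorry`; `N = 2`; guard `ZhUnity ∧ SlotsNondegenerate₁₃`; route-facing; namespace `…Theorems.BalabanUVNodesN27SpineRecord`.

WHAT IS KERNEL-CHECKED ([bookkeeping]; the sibling plug C `…OneTermN22SectorRoad` (p650950) VERBATIM except the `h22'` line and the swapped rows): ★★★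
`spineGivenEndpointR13SepCoPHV_of_liveV5PinsAtCrOfRecord₁₃VAt_cut_bareLedgerReadingV_kernelFaces_n22GenAnalyticNonexpansive_offLiveOneTerm_v5pins_bFree` ⊢ **`SpineGivenEndpointR13SepCoPHV` BY
NAME**.  `h22' :=` J63's socket applied per guarded admissible tuple to the displayed rows (J63's binders VERBATIM under `x ↦ x F θ`, `N ↦ 2`, `θ ↦ θ.toStage13Params`, EVERY row guarded
`Provisos₁₃CoPH → guard → Admissible →`; `0 < θ.γ` from `Admissible`; bound histories `g` renamed `gh`, J63's `hκ₀` (the `κ∕2` threshold) renamed `hκh` — this file's `B g` being node N16's letters and `hκ₀` node U3's threshold row); the towers are def-W1's GENERATOR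
towers `Gn F θ K : GenTower`, the law and the output bound ∕ term holomorphy are read at the RUN towers `truncRun K (toClusterTower (Gn F θ K))`; `h18' :=` dag-n18-w4
`kernelStepRateOfRecord₁₃_mono` (rate lowered `κ₅ ↦ (ℓ F θ).κ` along `hℓκ`, `hκ₅`; constant raised `C₅ ↦ (ℓ F θ).C₅` along `hC₅ℓ`) into
`n18At_u3OfRecord₁₃_objectsOfRecord₁₃_of_kernelStepRateOfRecord₁₃` — as in C.  Displayed: the four pins · `h16` · `hs hκ hcr hκ₀` · `hK` · `hlim h5 hC₅ hC₅ℓ` · type letters `𝔸 Ec`,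
`m' M hM`, generator towers `Gn`, reading maps `emb`, W1-20's law `hloc` at the run towers, space tables `sp`, numerals `κ₅ C₅ κ κE δ₀ B₃ r R r₀ ϱ Mb cw cS Bq` (NO `ω₁ ν`), family
`aw`, admissibility domains `Adm` with `hκh hδ₀ hB₃ hr hBo hκE`, (Adm-run) `hAdm`, the ANALYTIC READING (AR): complex normed spaces `Pot`, readings `ρA`, functionals `A` with
(AR-fact) `hGA`, (AR-holo) `hA`, the bound `hMbA`, (AR-adm) `hAdmr`, (AR-dom₁∕₂) `hρ₁ hρ₂`, NON-EXPANSIVE weight table rows `haw hawcw` + margin clause `hC1 : 4·Mb·cw∕ϱ < 1`, `hMb0 hϱ hR`; SECTOR HOLOMORPHY IN THE COMPLEX LAST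
COUPLING: sector sets `O`, values `V`, `hcS hBq hballS hholS hbdS`; NO growth-rate rows; NO output-bound row;
complexified readings `ι Φ U` with `hU hrU hEhol hΦemb hΦsp`, site weights `w` with `hw₀ hw htail`, letter rows `hκ₅ hω hθω hℓκ hC₉` · `hβ23 hβ1 hmatch hend hradii hclass hH3 hsel3 hβw` ·
live `hζm h20 h21 hlinkBareV` · off-live ONE row `htarget`.  The ν-rowed parent is G11 `…OneTermN22GenAnalytic` (p664446).

HONEST FRAMING (binding): COMPOSITE-node bookkeeping BY NAME; a REDUCTION, not a discharge; every displayed row a HYPOTHESIS or a decided MODEL (0∕1 today; K0⁷ OPEN).  Per dag-n22-c's own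
framing of J57∕J59∕J60∕J62∕J63 (the margin clause is an «ε₁ sufficiently small»-type reading of [II] p. 18, not a printed inequality): NE9 ∕ NE5 are NOT IN PRINT for d = 4; N18's letter `h5` is node N18's content (King's mechanism, NOT PRINTED for d = 4); (AR) is the n22 cell's UNPRINTED hypothesis
SHAPE (its reading of [II] (2.14)–(2.15) p. 15 with the older terms as independent variables, GAPS G-ne9p2-5); sector holomorphy in the complex last coupling is the cell's reading of [I] p. 263 «(or analytic)» ∕ p. 266 (nothing quantitative printed); (Adm-run) likewise (GAPS G-t4-U3-1∕-3: [I] prints the recursion (0.23) p. 256, (2.12)–(2.13) p. 268 and the C^∞ clause p. 263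
without constants — NOTHING quantitative in the older couplings); the output bound is the printed TYPE (1.18); readings ∕ tails ∕ law are NODE A ∕ N09 ∕ N10 ∕ def-W1 objects; the rows
are jointly satisfiable with `ℓ.Signs` iff `θ₅ν < 1`.  `hlinkBareV` = NODE O's world (UNPRINTED content, 0 instances); N11 NOT READ; `hβw` = K1's window currency (K1⁹ OPEN); nothing
of Bałaban's or King's asserted or instantiated; NOT `stub_rates13HV` ∕ `stub_expansion13HV`; N14–N22 ∕ N27 NOT discharged (the chair books, R417); K3⁸ OPEN, NOT claimed; counts UNMOVED
(typed 28∕28 · discharged 5∕27, A 5∕28); one finite four-torus programme at fixed `ε` — NOT ℝ⁴, NOT OS, NOT a mass gap, NOT Clay.  No decl below carries a cite tag.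
-/



set_option autoImplicit false

namespace Summit.QuantumFields.YangMills.Theorems.BalabanUVNodesN27SpineRecord
open scoped BigOperators Matrix Matrix.Norms.L2Operator
open Finset MeasureTheory
open Literature.MathematicalPhysics.QuantumFieldTheory.Balaban1983to89
open T4OutputRate T4RecentScale T4GoodClassBudget T4CauchySum T4TowerRateComposition T4TowerRateDischarge
open T4EtaRateMin (Readings NE3Shape)
open T4RateLiaison (GaugeDominated)
open FlowStep (RGEqH prefixOf)
open TreeLengthTorus (TFaceConnected torusTreeLen)
open B12TreeDecay (kappa₀)
open Summit.QuantumFields.BalabanUV.T4Continuum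
open AveragingDeficitDualResidual (dualC1 dualC2)
open AveragingDeficitDerivWallProof (wallConst)
open AveragingDeficitPeriodicCounting (IsPeriodicDir)
open MinimalActionSandwich (IsMinimiser minAct)
open MinimalActionRate (sfClass)
open MinimalActionRefine (RegularSup gradConst)
open NE3EnergyShapes (IsUnitarySite IsPeriodicSite)
open NE3.LeafIndexSockets (LeafH3sup)
open Summit.QuantumFields.BalabanUV.T4Continuum.Spine
open Summit.QuantumFields.BalabanUV.T4Continuum.Spine.NE4 (runFlow)
open Summit.QuantumFields.BalabanUV.T4Continuum.NE1p.DressedRoot (DressedTower DressedStabilityStrict)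
open Summit.QuantumFields.YangMills.BalabanUVNodes.N19LedgerLinkSync (LedgerDataSync LedgerAtSync)
open YMDAG.UVSplit
open Summit.QuantumFields.YangMills.BalabanUVNodes.N16HolderDefs (CovRootHolder N16HolderAt)
open Summit.QuantumFields.YangMills.BalabanUVNodes.SpineRatesHolder (RatesHolderAt)
open Literature.MathematicalPhysics.QuantumFieldTheory.Balaban1983to89.T4Continuum (T4Family ULoop)
open Node00 (Stage13HParams datumOfRecord₁₃CoPH SiteSeqKey U3Letters₁₁ NE3Letters₁₁ ne3ConstLayerOfRecord₁₁ ne3NperOfRecord₁₁ ne3DomOfRecord₁₁ ZetaMeasurable ppSelLiveOfRecord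
  EOfRecord₁₃ wOfRecord₉ localBgMeasurable)
open Literature.MathematicalPhysics.QuantumFieldTheory.Balaban1983to89.B12Sec2to5 (betaPrime510)
open Literature.MathematicalPhysics.QuantumFieldTheory.Balaban1983to89.Node00.U3OfKernels (objectsOfRecord₁₃ KernelDecayOfRecord₁₃)
open Literature.MathematicalPhysics.QuantumFieldTheory.Balaban1983to89.Node00.U3KernelLetters (GeometricIncrementsOfRecord₁₃ WindowedNE9OfRecord₁₃ WindowedDecayOfRecord₁₃
  WindowedStepRateOfRecord₁₃)
open Summit.QuantumFields.YangMills.BalabanUVNodes.N16PinnedLayer13CoPH (N16PinnedLoose N16LettersEnd rateCarriers_ne3_of_pinnedLoose)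
open Summit.QuantumFields.YangMills.BalabanUVNodes.N19TargetClassWeightsE1Keyed
open YMDAG.N14.TopBorn (Ne1PinnedOfRecord n14At_rateCarriersOfRecord₁₃CoPH_of_pinned)
open Summit.QuantumFields.YangMills.BalabanUVNodes.N15.GenuineRecord (fullGSizedObjects n15At_fullGSizedObjects_family)
open Summit.QuantumFields.YangMills.BalabanUVNodes.N15.AtKeyedHome (neZero_blockFactor)
open T4WeightBudget T4IndicatorShell T4ContinuumYM4Torus T4ApexHybrid
open Summit.QuantumFields.YangMills.Theses.BalabanUVNodes (SpineGivenEndpointR13SepCoPHV)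
open NE7 (Target)
open Summit.QuantumFields.YangMills.BalabanUVNodes.N20OffLiveOneTermReading (crOneTerm₁₃ h20_shape_crOneTerm₁₃ h21_shape_crOneTerm₁₃ extraction_crOneTerm₁₃ core_crOneTerm₁₃_iff_target)
open Literature.MathematicalPhysics.QuantumFieldTheory.Balaban1983to89.Node00 (MatA)
open Literature.MathematicalPhysics.QuantumFieldTheory.Balaban1983to89.Node00.LocalizedSum17 (ReadingMaps Localizes17OfRecord₁₃)
open Literature.MathematicalPhysics.QuantumFieldTheory.Balaban1983to89.Node00.Sect2 (domSys domCount CPair)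
open Literature.MathematicalPhysics.QuantumFieldTheory.Balaban1983to89.Node00.W1 (ClusterTower GenTower OlderTerms olderOf recTerm truncRun toClusterTower)
open Literature.MathematicalPhysics.QuantumFieldTheory.Balaban1983to89.Node00.U3OfKernels (histPrefix)
open Literature.MathematicalPhysics.QuantumFieldTheory.Balaban1983to89.Node00.U3KernelLetters (KernelStepRateOfRecord₁₃ PolLimitsExistOfRecord₁₃)
open Literature.MathematicalPhysics.QuantumFieldTheory.Balaban1983to89.TreeLengthTorus (TPt)
open Literature.MathematicalPhysics.QuantumFieldTheory.Balaban1983to89.B12Decay510 (delta1)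
open Literature.MathematicalPhysics.QuantumFieldTheory.Balaban1983to89.B12Decay510Window (K₁)
open Literature.MathematicalPhysics.QuantumFieldTheory.Balaban1983to89.B12Decay510Torus (distCT nearT)
open YMDAG.N22.KernelFading (n22At_u3OfRecord₁₃_of_kernelStepRate_genAnalyticNonexpansive)
open YMDAG.N18.KernelStepRateKingMechanism (kernelStepRateOfRecord₁₃_mono)
open YMDAG.N18.AtRecordOfKernelLetters (n18At_u3OfRecord₁₃_objectsOfRecord₁₃_of_kernelStepRateOfRecord₁₃)
variable (K₀ : ℕ) (jc : (F : T4Family) → (θ : Stage13HParams F 2) → θ.Provisos₁₃CoPH F 2 → (ℕ → ℝ) → List (ULoop F) → ℕ → ℕ)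
  (sh : ShellSplit₁₃CoPH 2 K₀)
  (β : ℝ) (𝔯 : RateReading₁₃CoPH 2)
  (ℓ : (F : T4Family) → Stage13HParams F 2 → U3Letters₁₁)
  (ℓ₃ : T4Family → NE3Letters₁₁) (g B c' : T4Family → ℝ)
variable (𝔸 : (F : T4Family) → Stage13HParams F 2 → Type) (Ec : (F : T4Family) → Stage13HParams F 2 → ℕ → ℕ → Type*)
  [∀ (F : T4Family) (θ : Stage13HParams F 2) (K k : ℕ), NormedAddCommGroup (Ec F θ K k)] [∀ (F : T4Family) (θ : Stage13HParams F 2) (K k : ℕ), NormedSpace ℂ (Ec F θ K k)]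
  (m' M : (F : T4Family) → Stage13HParams F 2 → ℕ) [hM0 : ∀ (F : T4Family) (θ : Stage13HParams F 2), NeZero (M F θ)]
  (Gn : (F : T4Family) → (θ : Stage13HParams F 2) → (K : ℕ) → GenTower (F.P K) (𝔸 F θ) (M F θ))
  (emb : (F : T4Family) → (θ : Stage13HParams F 2) → ReadingMaps F (MatA 2) (𝔸 F θ))
  (sp : (F : T4Family) → (θ : Stage13HParams F 2) → (K k : ℕ) → (domSys (F.P K) (M F θ) (k + 1)).Dom → Set (CPair (F.P K) (𝔸 F θ)))
  (κ₅ C₅ κ κE δ₀ B₃ r R r₀ ϱ Mb cw cS Bq : (F : T4Family) → Stage13HParams F 2 → ℝ)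
  (aw : (F : T4Family) → Stage13HParams F 2 → ℕ → ℕ → ℕ → ℝ)
  (Adm : (F : T4Family) → (θ : Stage13HParams F 2) → (K k : ℕ) → OlderTerms (F.P K) (𝔸 F θ) (M F θ) k → Prop)
  (Pot : (F : T4Family) → (θ : Stage13HParams F 2) → ℕ → ℕ → Type*)
  [∀ (F : T4Family) (θ : Stage13HParams F 2) (K k : ℕ), NormedAddCommGroup (Pot F θ K k)] [∀ (F : T4Family) (θ : Stage13HParams F 2) (K k : ℕ), NormedSpace ℂ (Pot F θ K k)]
  (ρA : (F : T4Family) → (θ : Stage13HParams F 2) → (K k : ℕ) → OlderTerms (F.P K) (𝔸 F θ) (M F θ) k → Pot F θ K k)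
  (A : (F : T4Family) → (θ : Stage13HParams F 2) → (K k : ℕ) → ℝ → CPair (F.P K) (𝔸 F θ) → (domSys (F.P K) (M F θ) (k + 1)).Dom → Pot F θ K k → ℂ)
  (O : (F : T4Family) → (θ : Stage13HParams F 2) → ℕ → Set ℂ)
  (V : (F : T4Family) → (θ : Stage13HParams F 2) → (K k : ℕ) → OlderTerms (F.P K) (𝔸 F θ) (M F θ) k → CPair (F.P K) (𝔸 F θ) → (domSys (F.P K) (M F θ) (k + 1)).Dom → ℂ)
  (ι : (F : T4Family) → (θ : Stage13HParams F 2) →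
      (letI := θ.instVβ₁; letI := θ.instVβ₂;
      (K k : ℕ) → (domSys (F.P K) (M F θ) (k + 1)).Dom → ((Fin (F.P K).d → Site (F.P K) (k + 1) → θ.Vβ) →L[ℝ] Ec F θ K k)))
  (Φ : (F : T4Family) → (θ : Stage13HParams F 2) → (K k : ℕ) → (domSys (F.P K) (M F θ) (k + 1)).Dom → Ec F θ K k → CPair (F.P K) (𝔸 F θ))
  (U : (F : T4Family) → (θ : Stage13HParams F 2) → (K k : ℕ) → (domSys (F.P K) (M F θ) (k + 1)).Dom → Set (Ec F θ K k))
  (w : (F : T4Family) → (θ : Stage13HParams F 2) → (K k : ℕ) → (domSys (F.P K) (M F θ) (k + 1)).Dom → Site (F.P K) (k + 1) → ℝ)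

open Classical in
/-- ★★★ **THE ITEM `SpineGivenEndpointR13SepCoPHV` AT EVERY VERSION SLOT — LIVE: ALL PINS, NODE U3 AT THE LIMITING KERNELS OF RECORD WITH THE N22 FACE ⟸ dag-n22-c's ROAD 2 IN
GENERATOR CURRENCY FROM A NON-EXPANSIVE ANALYTIC READING (J63: N18's letter + (AR) with `aw ≤ c_w`, `4M_b c_w∕ϱ < 1` + sector holomorphy in the complex last coupling + (Adm-run) + the STANDING letter rows; NO growth rate ν, NO step schema, NO output-bound row) AND THE N18 FACE ⟸
N18's LIMIT LETTER `h5` (by monotonicity), N19′ AT THE BARE LEDGER READING; OFF-LIVE: ONE (B)-FREE TARGET ROW** (plug C's proof with `h22' :=` J63's socket).  NOT a discharge; every row a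
HYPOTHESIS or a decided MODEL; NE9 ∕ NE5 NOT IN PRINT for d = 4; the schemas and N18's letter are DISPLAYED, asserted for no family; N11 NOT READ; no node discharged; K3⁸ OPEN. [bookkeeping] -/
theorem spineGivenEndpointR13SepCoPHV_of_liveV5PinsAtCrOfRecord₁₃VAt_cut_bareLedgerReadingV_kernelFaces_n22GenAnalyticNonexpansive_offLiveOneTerm_v5pins_bFree
    (ksel : (F : T4Family) → (θ : Stage13HParams F 2) → θ.Provisos₁₃CoPH F 2 → (ℕ → ℝ) → List (ULoop F) → ℕ)
    (hpin1 : Ne1PinnedOfRecord 𝔯)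
    (hpin2 : ∃ (b aS : ℝ) (ν μ α β' : Fin 4) (c35 p : ℝ), 0 < b ∧ 0 < aS ∧
      ∀ (F : T4Family) (θ : Stage13HParams F 2) (hP : θ.Provisos₁₃CoPH F 2) (g₀ : ℕ → ℝ) (os : List (ULoop F)) (k : ℕ),
        (𝔯.lit F θ hP g₀ os).ne2 k = haveI := neZero_blockFactor F; fullGSizedObjects 3 F.hL b aS ν μ α β' c35 p)
    (hpinL : N16PinnedLoose 𝔯 ℓ₃ B)
    (hpin : ∀ (F : T4Family) (θ : Stage13HParams F 2) (hP : θ.Provisos₁₃CoPH F 2) (g₀ : ℕ → ℝ) (os : List (ULoop F)),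
      (𝔯.lit F θ hP g₀ os).u3 = objectsOfRecord₁₃ F 2 θ.toStage13Params (ℓ F θ))
    (h16 : ∀ (F : T4Family), (∃ θ : Stage13HParams F 2, θ.Provisos₁₃CoPH F 2 ∧ (θ.ZhUnity F 2 ∧ θ.SlotsNondegenerate₁₃ F 2) ∧ θ.Admissible F 2) →
      N16HolderAt (ne3OfRecord₁₁ F { ne3ConstLayerOfRecord₁₁ F 2 (ℓ₃ F) with
        dom := {V | V ∈ ne3DomOfRecord₁₁ F 2 0 0 ∧ V ∈ sfClass 4 F.L (ne3NperOfRecord₁₁ F 0 0) ((ℓ₃ F).ε / B F) 0} }) β)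
    (hs : ∀ (F : T4Family) (θ : Stage13HParams F 2), θ.Provisos₁₃CoPH F 2 → (θ.ZhUnity F 2 ∧ θ.SlotsNondegenerate₁₃ F 2) → θ.Admissible F 2 → (ℓ F θ).Signs)
    (hκ : ∀ (F : T4Family) (θ : Stage13HParams F 2), θ.Provisos₁₃CoPH F 2 → (θ.ZhUnity F 2 ∧ θ.SlotsNondegenerate₁₃ F 2) → θ.Admissible F 2 → 0 < (ℓ F θ).κ)
    (hcr : ∀ (F : T4Family) (θ : Stage13HParams F 2), θ.Provisos₁₃CoPH F 2 → (θ.ZhUnity F 2 ∧ θ.SlotsNondegenerate₁₃ F 2) → θ.Admissible F 2 →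
      betaPrime510 4 1 (ℓ F θ).κ ≤ (ℓ F θ).cr)
    (hκ₀ : ∀ (F : T4Family) (θ : Stage13HParams F 2), θ.Provisos₁₃CoPH F 2 → (θ.ZhUnity F 2 ∧ θ.SlotsNondegenerate₁₃ F 2) → θ.Admissible F 2 → kappa₀ (4 * 2 ^ 4) (2 * 4) ≤ (ℓ F θ).κ)
    (hK : ∀ (μ ν : Fin 4) (F : T4Family) (θ : Stage13HParams F 2), θ.Provisos₁₃CoPH F 2 → (θ.ZhUnity F 2 ∧ θ.SlotsNondegenerate₁₃ F 2) → θ.Admissible F 2 →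
      KernelDecayOfRecord₁₃ F 2 θ.toStage13Params μ ν (ℓ F θ).κ)
    -- node N18's LIMIT letter at the rate `κ₅` with constant `C₅` (J49's `h5`), keyed to `ℓ F θ` by domination (`hC₅ℓ`, `hℓκ`∕`hκ₅`); (1.21)
    (hlim : ∀ (F : T4Family) (θ : Stage13HParams F 2), θ.Provisos₁₃CoPH F 2 → (θ.ZhUnity F 2 ∧ θ.SlotsNondegenerate₁₃ F 2) → θ.Admissible F 2 → PolLimitsExistOfRecord₁₃ F 2 θ.toStage13Params)
    (h5 : ∀ (F : T4Family) (θ : Stage13HParams F 2), θ.Provisos₁₃CoPH F 2 → (θ.ZhUnity F 2 ∧ θ.SlotsNondegenerate₁₃ F 2) → θ.Admissible F 2 →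
      KernelStepRateOfRecord₁₃ F 2 θ.toStage13Params (κ₅ F θ) (ℓ F θ).θ₅ (C₅ F θ))
    (hC₅ : ∀ (F : T4Family) (θ : Stage13HParams F 2), θ.Provisos₁₃CoPH F 2 → (θ.ZhUnity F 2 ∧ θ.SlotsNondegenerate₁₃ F 2) → θ.Admissible F 2 → 0 ≤ C₅ F θ) (hC₅ℓ : ∀ (F : T4Family) (θ : Stage13HParams F 2), θ.Provisos₁₃CoPH F 2 → (θ.ZhUnity F 2 ∧ θ.SlotsNondegenerate₁₃ F 2) → θ.Admissible F 2 → C₅ F θ ≤ (ℓ F θ).C₅)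
    -- dag-n22-c J63 §'s binders (`…N22AtRecordOfGenAnalyticNonexpansive` :152–:218) under `x ↦ x F θ`: leaf G11's rows with the growth rate `ν` and the geometric channel bound GONE —
    -- NON-EXPANSIVE analytic reading: weight table `aw ≤ c_w` (`haw hawcw`) with the margin clause `hC1 : 4M_b c_w∕ϱ < 1`; sector holomorphy in the complex last coupling (`O V hcS hBq hballS hholS hbdS`);
    -- (AR) `Pot ρA A hGA hA hMbA hAdmr hρ₁ hρ₂`, `hMb0 hϱ hR`; the letter block's STANDING rows `hθω : θ₅ ≤ ω²`, `hℓκ`, `hκ₅`, `hC₉` — N18's rate DECOUPLED from the recursion's constants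
    (hM : ∀ (F : T4Family) (θ : Stage13HParams F 2), θ.Provisos₁₃CoPH F 2 → (θ.ZhUnity F 2 ∧ θ.SlotsNondegenerate₁₃ F 2) → θ.Admissible F 2 → M F θ = F.L ^ m' F θ)
    (hloc : ∀ (F : T4Family) (θ : Stage13HParams F 2), θ.Provisos₁₃CoPH F 2 → (θ.ZhUnity F 2 ∧ θ.SlotsNondegenerate₁₃ F 2) → θ.Admissible F 2 →
      Localizes17OfRecord₁₃ F 2 θ.toStage13Params (fun K => truncRun K (toClusterTower (Gn F θ K))) (emb F θ))
    (hκh : ∀ (F : T4Family) (θ : Stage13HParams F 2), θ.Provisos₁₃CoPH F 2 → (θ.ZhUnity F 2 ∧ θ.SlotsNondegenerate₁₃ F 2) → θ.Admissible F 2 → kappa₀ (4 * 2 ^ 4) (2 * 4) ≤ κ F θ / 2)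
    (hδ₀ : ∀ (F : T4Family) (θ : Stage13HParams F 2), θ.Provisos₁₃CoPH F 2 → (θ.ZhUnity F 2 ∧ θ.SlotsNondegenerate₁₃ F 2) → θ.Admissible F 2 → 0 < δ₀ F θ)
    (hB₃ : ∀ (F : T4Family) (θ : Stage13HParams F 2), θ.Provisos₁₃CoPH F 2 → (θ.ZhUnity F 2 ∧ θ.SlotsNondegenerate₁₃ F 2) → θ.Admissible F 2 → 0 ≤ B₃ F θ)
    (hr : ∀ (F : T4Family) (θ : Stage13HParams F 2), θ.Provisos₁₃CoPH F 2 → (θ.ZhUnity F 2 ∧ θ.SlotsNondegenerate₁₃ F 2) → θ.Admissible F 2 → 0 < r F θ)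
    (hκE : ∀ (F : T4Family) (θ : Stage13HParams F 2), θ.Provisos₁₃CoPH F 2 → (θ.ZhUnity F 2 ∧ θ.SlotsNondegenerate₁₃ F 2) → θ.Admissible F 2 → κ F θ ≤ κE F θ)
    (hAdm : ∀ (F : T4Family) (θ : Stage13HParams F 2), θ.Provisos₁₃CoPH F 2 → (θ.ZhUnity F 2 ∧ θ.SlotsNondegenerate₁₃ F 2) → θ.Admissible F 2 →
      ∀ K, ∀ gh ∈ Window θ.γ, ∀ k, Adm F θ K k (olderOf (recTerm (Gn F θ K) fun n => ((gh n : ℝ) : ℂ)) k))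
    (hGA : ∀ (F : T4Family) (θ : Stage13HParams F 2), θ.Provisos₁₃CoPH F 2 → (θ.ZhUnity F 2 ∧ θ.SlotsNondegenerate₁₃ F 2) → θ.Admissible F 2 →
      ∀ (K k : ℕ), ∀ t ∈ Set.Ioc (0 : ℝ) θ.γ, ∀ (old : OlderTerms (F.P K) (𝔸 F θ) (M F θ) k), Adm F θ K k old → ∀ (X : (domSys (F.P K) (M F θ) (k + 1)).Dom), ∀ φ ∈ sp F θ K k X,
      ((Gn F θ K) k).E ((t : ℝ) : ℂ) old φ X = A F θ K k t φ X (ρA F θ K k old))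
    (hA : ∀ (F : T4Family) (θ : Stage13HParams F 2), θ.Provisos₁₃CoPH F 2 → (θ.ZhUnity F 2 ∧ θ.SlotsNondegenerate₁₃ F 2) → θ.Admissible F 2 →
      ∀ (K k : ℕ), ∀ t ∈ Set.Ioc (0 : ℝ) θ.γ, ∀ (X : (domSys (F.P K) (M F θ) (k + 1)).Dom), ∀ φ ∈ sp F θ K k X, DifferentiableOn ℂ (A F θ K k t φ X) (Metric.ball 0 (R F θ)))
    (hMbA : ∀ (F : T4Family) (θ : Stage13HParams F 2), θ.Provisos₁₃CoPH F 2 → (θ.ZhUnity F 2 ∧ θ.SlotsNondegenerate₁₃ F 2) → θ.Admissible F 2 →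
      ∀ (K k : ℕ), ∀ t ∈ Set.Ioc (0 : ℝ) θ.γ, ∀ (X : (domSys (F.P K) (M F θ) (k + 1)).Dom), ∀ φ ∈ sp F θ K k X, ∀ p ∈ Metric.ball (0 : Pot F θ K k) (R F θ),
      ‖A F θ K k t φ X p‖ ≤ Mb F θ * Real.exp (-(κE F θ * (domSys (F.P K) (M F θ) (k + 1)).dj X)))
    (hAdmr : ∀ (F : T4Family) (θ : Stage13HParams F 2), θ.Provisos₁₃CoPH F 2 → (θ.ZhUnity F 2 ∧ θ.SlotsNondegenerate₁₃ F 2) → θ.Admissible F 2 →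
      ∀ (K k : ℕ) (old : OlderTerms (F.P K) (𝔸 F θ) (M F θ) k), Adm F θ K k old → ‖ρA F θ K k old‖ ≤ r₀ F θ)
    (hρ₁ : ∀ (F : T4Family) (θ : Stage13HParams F 2), θ.Provisos₁₃CoPH F 2 → (θ.ZhUnity F 2 ∧ θ.SlotsNondegenerate₁₃ F 2) → θ.Admissible F 2 →
      ∀ (K k : ℕ) (o o' : OlderTerms (F.P K) (𝔸 F θ) (M F θ) k), Adm F θ K k o → Adm F θ K k o' → ∀ (B' : ℝ), 0 ≤ B' →
      (∀ (k' : ℕ) (hk' : k' < k) (Y : (domSys (F.P K) (M F θ) (k' + 1)).Dom), ∀ φ' ∈ sp F θ K k' Y,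
        aw F θ K k (k' + 1) * (Real.exp (κE F θ * (domSys (F.P K) (M F θ) (k' + 1)).dj Y) * ‖o ⟨k' + 1, Nat.succ_lt_succ hk'⟩ Y φ' - o' ⟨k' + 1, Nat.succ_lt_succ hk'⟩ Y φ'‖) ≤ B') →
      ‖ρA F θ K k o - ρA F θ K k o'‖ ≤ B')
    (hρ₂ : ∀ (F : T4Family) (θ : Stage13HParams F 2), θ.Provisos₁₃CoPH F 2 → (θ.ZhUnity F 2 ∧ θ.SlotsNondegenerate₁₃ F 2) → θ.Admissible F 2 →
      ∀ (K k : ℕ) (o₁ o₂ o₃ : OlderTerms (F.P K) (𝔸 F θ) (M F θ) k), Adm F θ K k o₁ → Adm F θ K k o₂ → Adm F θ K k o₃ → ∀ (B' : ℝ), 0 ≤ B' →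
      (∀ (k' : ℕ) (hk' : k' < k) (Y : (domSys (F.P K) (M F θ) (k' + 1)).Dom), ∀ φ' ∈ sp F θ K k' Y,
        aw F θ K k (k' + 1) * (Real.exp (κE F θ * (domSys (F.P K) (M F θ) (k' + 1)).dj Y) *
          ‖o₁ ⟨k' + 1, Nat.succ_lt_succ hk'⟩ Y φ' - 2 * o₂ ⟨k' + 1, Nat.succ_lt_succ hk'⟩ Y φ' + o₃ ⟨k' + 1, Nat.succ_lt_succ hk'⟩ Y φ'‖) ≤ B') →
      ‖ρA F θ K k o₁ - (2 : ℂ) • ρA F θ K k o₂ + ρA F θ K k o₃‖ ≤ B')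
    (haw : ∀ (F : T4Family) (θ : Stage13HParams F 2), θ.Provisos₁₃CoPH F 2 → (θ.ZhUnity F 2 ∧ θ.SlotsNondegenerate₁₃ F 2) → θ.Admissible F 2 → ∀ K k j, 0 ≤ aw F θ K k j)
    (hawcw : ∀ (F : T4Family) (θ : Stage13HParams F 2), θ.Provisos₁₃CoPH F 2 → (θ.ZhUnity F 2 ∧ θ.SlotsNondegenerate₁₃ F 2) → θ.Admissible F 2 → ∀ K k j, aw F θ K k j ≤ cw F θ)
    (hC1 : ∀ (F : T4Family) (θ : Stage13HParams F 2), θ.Provisos₁₃CoPH F 2 → (θ.ZhUnity F 2 ∧ θ.SlotsNondegenerate₁₃ F 2) → θ.Admissible F 2 → 4 * Mb F θ * cw F θ / ϱ F θ < 1)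
    (hMb0 : ∀ (F : T4Family) (θ : Stage13HParams F 2), θ.Provisos₁₃CoPH F 2 → (θ.ZhUnity F 2 ∧ θ.SlotsNondegenerate₁₃ F 2) → θ.Admissible F 2 → 0 ≤ Mb F θ)
    (hϱ : ∀ (F : T4Family) (θ : Stage13HParams F 2), θ.Provisos₁₃CoPH F 2 → (θ.ZhUnity F 2 ∧ θ.SlotsNondegenerate₁₃ F 2) → θ.Admissible F 2 → 0 < ϱ F θ)
    (hR : ∀ (F : T4Family) (θ : Stage13HParams F 2), θ.Provisos₁₃CoPH F 2 → (θ.ZhUnity F 2 ∧ θ.SlotsNondegenerate₁₃ F 2) → θ.Admissible F 2 → r₀ F θ + ϱ F θ < R F θ)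
    (hcS : ∀ (F : T4Family) (θ : Stage13HParams F 2), θ.Provisos₁₃CoPH F 2 → (θ.ZhUnity F 2 ∧ θ.SlotsNondegenerate₁₃ F 2) → θ.Admissible F 2 → 0 < cS F θ)
    (hBq : ∀ (F : T4Family) (θ : Stage13HParams F 2), θ.Provisos₁₃CoPH F 2 → (θ.ZhUnity F 2 ∧ θ.SlotsNondegenerate₁₃ F 2) → θ.Admissible F 2 → 0 ≤ Bq F θ)
    (hballS : ∀ (F : T4Family) (θ : Stage13HParams F 2), θ.Provisos₁₃CoPH F 2 → (θ.ZhUnity F 2 ∧ θ.SlotsNondegenerate₁₃ F 2) → θ.Admissible F 2 →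
      ∀ K, ∀ s ∈ Set.Ioc (0 : ℝ) θ.γ, Metric.closedBall (s : ℂ) (cS F θ * s) ⊆ O F θ K)
    (hholS : ∀ (F : T4Family) (θ : Stage13HParams F 2), θ.Provisos₁₃CoPH F 2 → (θ.ZhUnity F 2 ∧ θ.SlotsNondegenerate₁₃ F 2) → θ.Admissible F 2 →
      ∀ (K k : ℕ) (old : OlderTerms (F.P K) (𝔸 F θ) (M F θ) k), Adm F θ K k old → ∀ (X : (domSys (F.P K) (M F θ) (k + 1)).Dom), ∀ φ ∈ sp F θ K k X,
      DifferentiableOn ℂ (fun z => ((Gn F θ K) k).E z old φ X) (O F θ K))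
    (hbdS : ∀ (F : T4Family) (θ : Stage13HParams F 2), θ.Provisos₁₃CoPH F 2 → (θ.ZhUnity F 2 ∧ θ.SlotsNondegenerate₁₃ F 2) → θ.Admissible F 2 →
      ∀ (K k : ℕ) (old : OlderTerms (F.P K) (𝔸 F θ) (M F θ) k), Adm F θ K k old → ∀ (X : (domSys (F.P K) (M F θ) (k + 1)).Dom), ∀ φ ∈ sp F θ K k X, ∀ s ∈ Set.Ioc (0 : ℝ) θ.γ,
      ∀ z ∈ Metric.closedBall (s : ℂ) (cS F θ * s), ‖((Gn F θ K) k).E z old φ X - V F θ K k old φ X‖ ≤ Bq F θ * Real.exp (-(κE F θ * (domSys (F.P K) (M F θ) (k + 1)).dj X)) * s ^ 2)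
    (hU : ∀ (F : T4Family) (θ : Stage13HParams F 2), θ.Provisos₁₃CoPH F 2 → (θ.ZhUnity F 2 ∧ θ.SlotsNondegenerate₁₃ F 2) → θ.Admissible F 2 → ∀ K k X, IsOpen (U F θ K k X))
    (hrU : ∀ (F : T4Family) (θ : Stage13HParams F 2), θ.Provisos₁₃CoPH F 2 → (θ.ZhUnity F 2 ∧ θ.SlotsNondegenerate₁₃ F 2) → θ.Admissible F 2 → ∀ K k X, Metric.ball (0 : Ec F θ K k) (r F θ) ⊆ U F θ K k X)
    (hEhol : ∀ (F : T4Family) (θ : Stage13HParams F 2), θ.Provisos₁₃CoPH F 2 → (θ.ZhUnity F 2 ∧ θ.SlotsNondegenerate₁₃ F 2) → θ.Admissible F 2 →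
      ∀ gh ∈ Window θ.γ, ∀ (K k : ℕ) (X : (domSys (F.P K) (M F θ) (k + 1)).Dom),
      DifferentiableOn ℂ (fun z => (truncRun K (toClusterTower (Gn F θ K)) k).E (histPrefix gh k) (Φ F θ K k X z) X) (U F θ K k X))
    (hΦemb : ∀ (F : T4Family) (θ : Stage13HParams F 2), θ.Provisos₁₃CoPH F 2 → (θ.ZhUnity F 2 ∧ θ.SlotsNondegenerate₁₃ F 2) → θ.Admissible F 2 →
      (letI := θ.instVβ₁; letI := θ.instVβ₂;
      ∀ (K k : ℕ) (X : (domSys (F.P K) (M F θ) (k + 1)).Dom) (Bf : Fin (F.P K).d → Site (F.P K) (k + 1) → θ.Vβ),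
        Φ F θ K k X (ι F θ K k X Bf) = emb F θ K k (fun l t => NormedSpace.exp (θ.ρ8 (Bf l t)))))
    (hΦsp : ∀ (F : T4Family) (θ : Stage13HParams F 2), θ.Provisos₁₃CoPH F 2 → (θ.ZhUnity F 2 ∧ θ.SlotsNondegenerate₁₃ F 2) → θ.Admissible F 2 →
      ∀ (K k : ℕ) (X : (domSys (F.P K) (M F θ) (k + 1)).Dom), ∀ z ∈ Metric.ball (0 : Ec F θ K k) (r F θ), Φ F θ K k X z ∈ sp F θ K k X)
    (hw₀ : ∀ (F : T4Family) (θ : Stage13HParams F 2), θ.Provisos₁₃CoPH F 2 → (θ.ZhUnity F 2 ∧ θ.SlotsNondegenerate₁₃ F 2) → θ.Admissible F 2 → ∀ K k X t, 0 ≤ w F θ K k X t)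
    (hw : ∀ (F : T4Family) (θ : Stage13HParams F 2), θ.Provisos₁₃CoPH F 2 → (θ.ZhUnity F 2 ∧ θ.SlotsNondegenerate₁₃ F 2) → θ.Admissible F 2 →
      (letI := θ.instVβ₁; letI := θ.instVβ₂; letI := θ.instιβ;
      ∀ (K k : ℕ) (X : (domSys (F.P K) (M F θ) (k + 1)).Dom) (l : Fin (F.P K).d) (t : Site (F.P K) (k + 1)) (cι : θ.ιβ),
        ‖ι F θ K k X (Pi.single l (Pi.single t (θ.bV cι)))‖ ≤ w F θ K k X t))
    (htail : ∀ (F : T4Family) (θ : Stage13HParams F 2), θ.Provisos₁₃CoPH F 2 → (θ.ZhUnity F 2 ∧ θ.SlotsNondegenerate₁₃ F 2) → θ.Admissible F 2 →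
      ∀ (K k : ℕ) (X : (domSys (F.P K) (M F θ) (k + 1)).Dom) (t : Site (F.P K) (k + 1)),
        let e : Site (F.P K) (k + 1) → TPt 4 (domCount (F.P K) (M F θ) (k + 1) * M F θ) := fun x i => (ZMod.cast (x i) : ZMod (domCount (F.P K) (M F θ) (k + 1) * M F θ));
        w F θ K k X t ≤ B₃ F θ * Real.exp (-δ₀ F θ * distCT (domCount (F.P K) (M F θ) (k + 1)) (M F θ) (e t) (nearT (M := M F θ) (e t) X)))
    (hκ₅ : ∀ (F : T4Family) (θ : Stage13HParams F 2), θ.Provisos₁₃CoPH F 2 → (θ.ZhUnity F 2 ∧ θ.SlotsNondegenerate₁₃ F 2) → θ.Admissible F 2 → delta1 (δ₀ F θ) (κ F θ) ((M F θ : ℝ) * 4) ≤ κ₅ F θ)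
    (hω : ∀ (F : T4Family) (θ : Stage13HParams F 2), θ.Provisos₁₃CoPH F 2 → (θ.ZhUnity F 2 ∧ θ.SlotsNondegenerate₁₃ F 2) → θ.Admissible F 2 → 0 < (ℓ F θ).ω)
    (hθω : ∀ (F : T4Family) (θ : Stage13HParams F 2), θ.Provisos₁₃CoPH F 2 → (θ.ZhUnity F 2 ∧ θ.SlotsNondegenerate₁₃ F 2) → θ.Admissible F 2 → (ℓ F θ).θ₅ ≤ (ℓ F θ).ω ^ 2)
    (hℓκ : ∀ (F : T4Family) (θ : Stage13HParams F 2), θ.Provisos₁₃CoPH F 2 → (θ.ZhUnity F 2 ∧ θ.SlotsNondegenerate₁₃ F 2) → θ.Admissible F 2 → (ℓ F θ).κ ≤ delta1 (δ₀ F θ) (κ F θ) ((M F θ : ℝ) * 4))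
    (hC₉ : ∀ (F : T4Family) (θ : Stage13HParams F 2), θ.Provisos₁₃CoPH F 2 → (θ.ZhUnity F 2 ∧ θ.SlotsNondegenerate₁₃ F 2) → θ.Admissible F 2 →
      (4 * (2 * C₅ F θ / (1 - (ℓ F θ).θ₅) + 2 * ((16 * Mb F θ * B₃ F θ ^ 2 / r F θ ^ 2) * Real.exp (delta1 (δ₀ F θ) (κ F θ) ((M F θ : ℝ) * 4) * ((M F θ : ℝ) * 4) * 3) * B12TreeDecay.K₀ (4 * 2 ^ 4) (2 * 4) * K₁ 4 (δ₀ F θ / 2))) / θ.γ +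
      ((16 * max ((6 * cS F θ ^ 2 + 32 * cS F θ + 64) / cS F θ ^ 2 * Bq F θ) (64 * Mb F θ * cw F θ ^ 2 / ϱ F θ ^ 2 * (Bq F θ * θ.γ / cS F θ) ^ 2 / (1 - 4 * Mb F θ * cw F θ / ϱ F θ)) * B₃ F θ ^ 2 / r F θ ^ 2) * Real.exp (delta1 (δ₀ F θ) (κ F θ) ((M F θ : ℝ) * 4) * ((M F θ : ℝ) * 4) * 3) * B12TreeDecay.K₀ (4 * 2 ^ 4) (2 * 4) *
        K₁ 4 (δ₀ F θ / 2)) * θ.γ / 2) / (ℓ F θ).ω ≤ (ℓ F θ).C₉)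
    (hβ23 : 2 / 3 < β) (hβ1 : β ≤ 1)
    (hmatch : ∀ F : T4Family, 0 < B F ∧ (ℓ₃ F).ε / B F ≤ (ℓ₃ F).b)
    (hend : N16LettersEnd 2 g ℓ₃)
    (hradii : ∀ F : T4Family, (ℓ₃ F).g = gradConst 4 (c' F) ∧ 0 ≤ c' F ∧ 0 < c' F ∧ (ℓ₃ F).b ≤ c' F ∧
      (2 : ℝ) ^ 91 * (F.L : ℝ) ^ 17 * c' F ≤ 1 ∧ (2 : ℝ) ^ 76 * (F.L : ℝ) ^ 12 * c' F ≤ (ℓ₃ F).ε ∧ (ℓ₃ F).ε / B F ≤ 1 / 4 ∧ 4 * ((ℓ₃ F).ε / B F) ≤ c' F)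
    (hclass : ∀ F : T4Family, 16 * B7Prop2Explicit.C0 4 * (ℓ₃ F).ε ≤ 3 ∧ 1024 * (4 + 1) * (4 + 4) * (F.L : ℝ) ^ 2 * (ℓ₃ F).ε ≤ 1)
    (hH3 : ∀ (F : T4Family) (θ : Stage13HParams F 2) (hP : θ.Provisos₁₃CoPH F 2) (g₀ : ℕ → ℝ) (os : List (ULoop F)) (k : ℕ),
      LeafH3sup 4 (rateCarriersOfRecord₁₃CoPH 𝔯 F θ hP g₀ os k).ne3.L (rateCarriersOfRecord₁₃CoPH 𝔯 F θ hP g₀ os k).ne3.Nper (rateCarriersOfRecord₁₃CoPH 𝔯 F θ hP g₀ os k).ne3.ε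
        (rateCarriersOfRecord₁₃CoPH 𝔯 F θ hP g₀ os k).ne3.b (c' F) (rateCarriersOfRecord₁₃CoPH 𝔯 F θ hP g₀ os k).ne3.dom)
    (hsel3 : ∀ (F : T4Family) (θ : Stage13HParams F 2) (hP : θ.Provisos₁₃CoPH F 2) (g₀ : ℕ → ℝ) (os : List (ULoop F)) (k : ℕ),
      ∃ sel : ℕ → (B7Prop1Explicit.Site 4 → Fin 4 → (Matrix (Fin 2) (Fin 2) ℂ)ˣ) → (B7Prop1Explicit.Site 4 → Fin 4 → (Matrix (Fin 2) (Fin 2) ℂ)ˣ),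
        (∀ V ∈ (rateCarriersOfRecord₁₃CoPH 𝔯 F θ hP g₀ os k).ne3.dom, ∀ j : ℕ,
          IsMinimiser 4 (sfClass 4 (rateCarriersOfRecord₁₃CoPH 𝔯 F θ hP g₀ os k).ne3.L (rateCarriersOfRecord₁₃CoPH 𝔯 F θ hP g₀ os k).ne3.Nper (rateCarriersOfRecord₁₃CoPH 𝔯 F θ hP g₀ os k).ne3.ε)
            (rateCarriersOfRecord₁₃CoPH 𝔯 F θ hP g₀ os k).ne3.L (rateCarriersOfRecord₁₃CoPH 𝔯 F θ hP g₀ os k).ne3.Nper j V (sel j V)) ∧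
        (∀ V ∈ (rateCarriersOfRecord₁₃CoPH 𝔯 F θ hP g₀ os k).ne3.dom, ∀ j : ℕ,
          RegularSup 4 (rateCarriersOfRecord₁₃CoPH 𝔯 F θ hP g₀ os k).ne3.L (rateCarriersOfRecord₁₃CoPH 𝔯 F θ hP g₀ os k).ne3.Nper (rateCarriersOfRecord₁₃CoPH 𝔯 F θ hP g₀ os k).ne3.b (c' F) j (sel j V)))
    (hβw : ∀ (F : T4Family) (θ : Stage13HParams F 2) (hP : θ.Provisos₁₃CoPH F 2), (θ.ZhUnity F 2 ∧ θ.SlotsNondegenerate₁₃ F 2) → θ.Admissible F 2 →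
      ∃ γ₀ b b' : ℝ, 0 < γ₀ ∧ 0 < b ∧ DagBinding.BetaBoundsInInterval (datumOfRecord₁₃CoPH F 2 θ hP).C.toB12 γ₀ b b')
    (hζm : ∀ (F : T4Family) (θ : Stage13HParams F 2), θ.Provisos₁₃CoPH F 2 → ((θ.ZhUnity F 2 ∧ θ.SlotsNondegenerate₁₃ F 2) ∧ θ.ppSel = ppSelLiveOfRecord F 2 θ.ν θ.τ9 (EOfRecord₁₃ F 2 θ.toStage13Params) (wOfRecord₉ F 2 θ.toStage9Params)) → θ.Admissible F 2 →
      ZetaMeasurable F 2 θ.ζ)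
    (h20 : ∀ (F : T4Family) (θ : Stage13HParams F 2) (hP : θ.Provisos₁₃CoPH F 2), ((θ.ZhUnity F 2 ∧ θ.SlotsNondegenerate₁₃ F 2) ∧ θ.ppSel = ppSelLiveOfRecord F 2 θ.ν θ.τ9 (EOfRecord₁₃ F 2 θ.toStage13Params) (wOfRecord₉ F 2 θ.toStage9Params)) → θ.Admissible F 2 →
      ∀ (g₀ : ℕ → ℝ) (os : List (ULoop F)),
        ∃ W : ℕ → ℝ, RelWeightBound 1 (classSet₁₃ θ K₀ g₀) (weightA₁₃ θ hP K₀ g₀ os) (weightB₁₃ θ hP K₀ g₀ os) (badClass₁₃ θ K₀ g₀ (jc F θ hP g₀ os)) W)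
    (h21 : ∀ (F : T4Family) (θ : Stage13HParams F 2) (hP : θ.Provisos₁₃CoPH F 2), ((θ.ZhUnity F 2 ∧ θ.SlotsNondegenerate₁₃ F 2) ∧ θ.ppSel = ppSelLiveOfRecord F 2 θ.ν θ.τ9 (EOfRecord₁₃ F 2 θ.toStage13Params) (wOfRecord₉ F 2 θ.toStage9Params)) → θ.Admissible F 2 →
      ∀ (g₀ : ℕ → ℝ) (os : List (ULoop F)),
        ∃ Wsh : ℕ → ℝ, ShellWeightBound 1 (classSet₁₃ θ K₀ g₀) (weightA₁₃ θ hP K₀ g₀ os) (weightB₁₃ θ hP K₀ g₀ os) (sh F θ hP g₀ os).1 (sh F θ hP g₀ os).2 Wsh)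
    (hlinkBareV : ∀ (F : T4Family) (θ : Stage13HParams F 2) (hP : θ.Provisos₁₃CoPH F 2), ((θ.ZhUnity F 2 ∧ θ.SlotsNondegenerate₁₃ F 2) ∧ θ.ppSel = ppSelLiveOfRecord F 2 θ.ν θ.τ9 (EOfRecord₁₃ F 2 θ.toStage13Params) (wOfRecord₉ F 2 θ.toStage9Params)) → θ.Admissible F 2 →
      ∀ (γ gIR b : ℝ) (g₀ : ℕ → ℝ), (datumOfRecord₁₃CoPH F 2 θ hP).Tuned γ gIR g₀ → γ ≤ θ.γ → γ ^ 2 ≤ Real.exp (-1) → 0 < b →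
      (∀ K m, 0 ≤ m → m < K → b ≤ (datumOfRecord₁₃CoPH F 2 θ hP).βfun m (prefixOf (runFlow (datumOfRecord₁₃CoPH F 2 θ hP) g₀ K) m)) →
      ∀ (os : List (ULoop F)) (k : ℕ),
      let S : SpineCarriers := crOfRecord₁₃VAt K₀ (jc F θ hP g₀ os) sh F θ hP g₀ os
      let R : RateCarriers 2 := rateCarriersOfRecord₁₃CoPH 𝔯 F θ hP g₀ os k
      let D : Datum F 2 := datumOfRecord₁₃CoPH F 2 θ hP
      letI := S.dec
      ∃ (_ : DecidableEq R.u3.C.Dom) (F' : Type) (ι' X' : Type) (_ : MeasurableSpace ι')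
        (L : LedgerDataSync R.u3.C F' ι' S.ι) (Rd : Readings ι' X') (bsel : (ℕ → ℝ) → ℝ) (EB : Functional R.u3.C R.u3.C.BgB)
        (g : ℕ → ℕ → ℝ)
        (uA : ℕ → ι' → R.u3.C.BgA) (uB : ℕ → ι' → R.u3.C.BgB)
        (Koff : ℕ) (cells : (K j : ℕ) → R.u3.C.Dom → Finset (Site (F.P (Koff + K)) j))
        (θ : ℝ)
        (rd : ι' → (B7Prop1Explicit.Site 4 → Fin 4 → (Matrix (Fin 2) (Fin 2) ℂ)ˣ)),
        (∀ K i, i ≤ K → g K i = runFlow D g₀ K i) ∧ (∀ K i, K < i → g K i = gIR) ∧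
        EB = (fun s => R.u3.EB (bsel s) s) ∧
        (∀ (Sz : ℕ → ℝ → S.ι → ℕ → ℝ) (E₀ : ℝ) (m : ℕ) (a : ℝ) (Cw Λg : ℝ),
          (∀ K t, |t| ≤ S.l₀ → ∀ τ ∈ S.T K \ S.Bad K t, ∀ v ∈ Rd.dom, ∀ j ≤ K,
            |∑ X ∈ L.fac K t τ with R.u3.C.scale X = j,
                (Real.log (Real.exp (EB (fun i => g (K + 1) (i + 1)) (uB K v) X
                    - EB (fun i => g (K + 1) (i + 1)) L.oneB X))
                  - Real.log (Real.exp (R.u3.EA (g K) (uA K v) X - R.u3.EA (g K) L.oneA X)))| ≤ Sz K t τ j) →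
          0 ≤ E₀ → 0 < a → a < 1 →
          (∀ K t, |t| ≤ S.l₀ → ∀ τ ∈ S.T K \ S.Bad K t, ∀ j ≤ K,
            Sz K t τ j ≤ S.vol * (E₀ * ((K : ℝ) + 1) ^ m * a ^ (K - j))) →
          (∀ K, Multiplicity (L.All K) R.u3.C.scale (fun X => Real.exp (-(R.u3.κ * R.u3.C.d X))) Cw S.vol Λg K) →
          (∀ K t, |t| ≤ S.l₀ → ∀ τ ∈ S.T K \ S.Bad K t,
            WindowMultiplicity (L.facO K t τ) L.scO L.wO Cw S.vol Λg (jlogOf L.Cl K) K) →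
          1 ≤ Λg → L.θ' ≤ Λg →
          LedgerAtSync { L with S := Sz, E₀ := E₀, m := m, a := a, Cw := Cw, Λg := Λg } S.l₀ S.vol S.T S.Bad
            (fun K t τ => S.A K t τ - S.shA K t τ) (fun K t τ => S.B K t τ - S.shB K t τ) Rd R.u3.EA EB R.u3.κ g uA uB
            R.u3.ω R.u3.ρ R.u3.θ (θ ^ ((3 : ℝ) * β - 2))) ∧
        (∀ K t, |t| ≤ S.l₀ → ∀ τ ∈ S.T K \ S.Bad K t,
          WindowMultiplicity (L.facO K t τ) L.scO L.wO L.Cw S.vol L.Λg (jlogOf L.Cl K) K) ∧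
        0 ≤ L.Cw ∧ 1 ≤ L.Λg ∧ L.θ' ≤ L.Λg ∧
        (∀ K, ∀ X ∈ L.All K,
          (cells K (R.u3.C.scale X + Koff) X).Nonempty ∧ TFaceConnected (cells K (R.u3.C.scale X + Koff) X)) ∧
        (∀ K j, Set.InjOn (cells K j) ↑((L.All K).filter fun X => R.u3.C.scale X + Koff = j)) ∧
        (∀ K, ∀ X ∈ L.All K, torusTreeLen (cells K (R.u3.C.scale X + Koff) X) ≤ R.u3.C.d X) ∧
        0 < θ ∧ θ ^ 6 = ((R.ne3.L : ℝ))⁻¹ ∧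
        (∀ v ∈ Rd.dom, rd v ∈ R.ne3.dom) ∧
        (∀ k, ∀ v ∈ Rd.dom, Rd.act k v = minAct 4 (sfClass 4 R.ne3.L R.ne3.Nper R.ne3.ε) R.ne3.L R.ne3.Nper k (rd v)) ∧
        (R.ne3.Nper : ℝ) ^ 4 ≤ Rd.vol ∧
        (∀ s ∈ Window γ, 0 < bsel s ∧ bsel s ≤ γ))
    (htarget : ∀ (F : T4Family) (θ : Stage13HParams F 2) (hP : θ.Provisos₁₃CoPH F 2), ((θ.ZhUnity F 2 ∧ θ.SlotsNondegenerate₁₃ F 2) ∧ ¬ θ.ppSel = ppSelLiveOfRecord F 2 θ.ν θ.τ9 (EOfRecord₁₃ F 2 θ.toStage13Params) (wOfRecord₉ F 2 θ.toStage9Params)) → θ.Admissible F 2 →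
        ForSmallCouplings (datumOfRecord₁₃CoPH F 2 θ hP) fun g₀ => ∀ os : List (ULoop F),
          (RatesHolderAt (datumOfRecord₁₃CoPH F 2 θ hP) (rateCarriersOfRecord₁₃CoPH 𝔯 F θ hP g₀ os (ksel F θ hP g₀ os)) β ∧
              ReadOutAt (datumOfRecord₁₃CoPH F 2 θ hP) (rateCarriersOfRecord₁₃CoPH 𝔯 F θ hP g₀ os (ksel F θ hP g₀ os)).u3 ∧
              (0 ≤ (rateCarriersOfRecord₁₃CoPH 𝔯 F θ hP g₀ os (ksel F θ hP g₀ os)).u3.ρ ∧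
                (rateCarriersOfRecord₁₃CoPH 𝔯 F θ hP g₀ os (ksel F θ hP g₀ os)).u3.ρ < 1)) →
            ∃ δ : ℕ → ℝ, Target ((F.side : ℝ) ^ 4) 1 δ (fun K => T4GenFunBounds.schemeZ ((datumOfRecord₁₃CoPH F 2 θ hP).scheme g₀) os (K₀ + K))) :
    SpineGivenEndpointR13SepCoPHV := by
  have hρ : ∀ (F : T4Family) (θ : Stage13HParams F 2), θ.Provisos₁₃CoPH F 2 → (θ.ZhUnity F 2 ∧ θ.SlotsNondegenerate₁₃ F 2) → θ.Admissible F 2 →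
      0 ≤ (ℓ F θ).ρ ∧ (ℓ F θ).ρ < 1 := fun F θ hP hG hθ => ⟨(hs F θ hP hG hθ).ρ_nonneg, (hs F θ hP hG hθ).ρ_lt_one⟩
  have h22' : ∀ (F : T4Family) (θ : Stage13HParams F 2), θ.Provisos₁₃CoPH F 2 → (θ.ZhUnity F 2 ∧ θ.SlotsNondegenerate₁₃ F 2) → θ.Admissible F 2 →
      ∀ k : ℕ, N22At (u3OfRecord₁₃ θ.toStage13Params (objectsOfRecord₁₃ F 2 θ.toStage13Params (ℓ F θ)) k) := fun F θ hP hG hθ k =>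
    n22At_u3OfRecord₁₃_of_kernelStepRate_genAnalyticNonexpansive F 2 θ.toStage13Params (ℓ F θ) (hs F θ hP hG hθ) hθ.toStage12.toStage9.gamma_pos (hlim F θ hP hG hθ) (hC₅ F θ hP hG hθ)
      (h5 F θ hP hG hθ) (m' F θ) (M F θ) (hM F θ hP hG hθ) (Gn F θ) (emb F θ) (hloc F θ hP hG hθ) (sp F θ) (hκh F θ hP hG hθ) (hδ₀ F θ hP hG hθ) (hB₃ F θ hP hG hθ) (hr F θ hP hG hθ)
      (hκE F θ hP hG hθ) (Adm F θ) (hAdm F θ hP hG hθ) (ρA F θ) (A F θ) (hGA F θ hP hG hθ) (hA F θ hP hG hθ) (hMbA F θ hP hG hθ) (hAdmr F θ hP hG hθ) (hρ₁ F θ hP hG hθ) (hρ₂ F θ hP hG hθ)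
      (haw F θ hP hG hθ) (hawcw F θ hP hG hθ) (hC1 F θ hP hG hθ) (hMb0 F θ hP hG hθ) (hϱ F θ hP hG hθ) (hR F θ hP hG hθ) (O F θ) (V F θ) (hcS F θ hP hG hθ) (hBq F θ hP hG hθ)
      (hballS F θ hP hG hθ) (hholS F θ hP hG hθ) (hbdS F θ hP hG hθ) (Ec F θ) (ι F θ) (Φ F θ) (U F θ) (hU F θ hP hG hθ) (hrU F θ hP hG hθ) (hEhol F θ hP hG hθ) (hΦemb F θ hP hG hθ)
      (hΦsp F θ hP hG hθ) (w F θ) (hw₀ F θ hP hG hθ) (hw F θ hP hG hθ) (htail F θ hP hG hθ) (hκ₅ F θ hP hG hθ) (hω F θ hP hG hθ) (hθω F θ hP hG hθ) (hℓκ F θ hP hG hθ) (hC₉ F θ hP hG hθ) k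
  have h18' : ∀ (F : T4Family) (θ : Stage13HParams F 2), θ.Provisos₁₃CoPH F 2 → (θ.ZhUnity F 2 ∧ θ.SlotsNondegenerate₁₃ F 2) → θ.Admissible F 2 →
      ∀ k : ℕ, N18At (u3OfRecord₁₃ θ.toStage13Params (objectsOfRecord₁₃ F 2 θ.toStage13Params (ℓ F θ)) k) := fun F θ hP hG hθ k =>
    n18At_u3OfRecord₁₃_objectsOfRecord₁₃_of_kernelStepRateOfRecord₁₃ F 2 θ.toStage13Params (ℓ F θ) k
      (kernelStepRateOfRecord₁₃_mono F 2 θ.toStage13Params (h5 F θ hP hG hθ) ((hℓκ F θ hP hG hθ).trans (hκ₅ F θ hP hG hθ)) (hs F θ hP hG hθ).θ₅_pos.le le_rfl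
        (hC₅ℓ F θ hP hG hθ) (hs F θ hP hG hθ).C₅_nonneg)
  exact fun F θ h v hG hθ _ _ =>
    hybridNE7Under_of_forSmallCouplings_stringwise (Node00.datumOfRecord₁₃SepCoPHV F 2 θ h v)
      (show ForSmallCouplings (Node00.datumOfRecord₁₃SepCoPHV F 2 θ h v) (fun g₀ => StringwiseHybridNE7 ((Node00.datumOfRecord₁₃SepCoPHV F 2 θ h v).scheme g₀)) from
        bodyBFree₁₃CoPH_of_split (fun F (θ : Stage13HParams F 2) => (θ.ZhUnity F 2 ∧ θ.SlotsNondegenerate₁₃ F 2)) (fun F (θ : Stage13HParams F 2) => θ.ppSel = ppSelLiveOfRecord F 2 θ.ν θ.τ9 (EOfRecord₁₃ F 2 θ.toStage13Params) (wOfRecord₉ F 2 θ.toStage9Params))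
          (bodyBFree₁₃CoPH_of_v5pins_bareLedgerReadingV_kernelFaces_at_crOfRecord₁₃VAt_cut K₀ jc sh β 𝔯 ℓ ℓ₃ g B c'
          (fun F (θ : Stage13HParams F 2) => (θ.ZhUnity F 2 ∧ θ.SlotsNondegenerate₁₃ F 2) ∧ θ.ppSel = ppSelLiveOfRecord F 2 θ.ν θ.τ9 (EOfRecord₁₃ F 2 θ.toStage13Params) (wOfRecord₉ F 2 θ.toStage9Params))
          ksel hpin1 hpin2 hpinL hpin (fun F hF => h16 F (hF.elim fun θ h => ⟨θ, h.1, h.2.1.1, h.2.2⟩)) (fun F θ hP hRg hθ => hs F θ hP hRg.1 hθ) (fun F θ hP hRg hθ => hκ F θ hP hRg.1 hθ)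
          (fun F θ hP hRg hθ => hcr F θ hP hRg.1 hθ) (fun F θ hP hRg hθ => hκ₀ F θ hP hRg.1 hθ) (fun μ ν F θ hP hRg hθ => hK μ ν F θ hP hRg.1 hθ) (fun F θ hP hRg hθ => h18' F θ hP hRg.1 hθ)
          (fun F θ hP hRg hθ => h22' F θ hP hRg.1 hθ) hβ23 hβ1 hmatch hend hradii hclass hH3 hsel3
          (fun F θ hP hRg hθ => hβw F θ hP hRg.1 hθ) (fun _ _ _ hRg _ => ⟨_, hRg.2⟩) hζm h20 h21 hlinkBareV)
          (bodyBFree₁₃CoPH_of_kernels_pin_bFree (crOneTerm₁₃ K₀) 𝔯 ksel (fun {F} (θ : Stage13HParams F 2) => ((θ.ZhUnity F 2 ∧ θ.SlotsNondegenerate₁₃ F 2) ∧ ¬ θ.ppSel = ppSelLiveOfRecord F 2 θ.ν θ.τ9 (EOfRecord₁₃ F 2 θ.toStage13Params) (wOfRecord₉ F 2 θ.toStage9Params))) ℓ β hpin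
            (fun F θ hP hRg hθ => ForSmallCouplings.of_forall fun g₀ os => by
              refine ⟨?_, ?_, ?_⟩
              · exact n14At_rateCarriersOfRecord₁₃CoPH_of_pinned 𝔯 hpin1 F θ hP g₀ os (ksel F θ hP g₀ os)
              · obtain ⟨b, aS, ν, μ, α, β', c35, p, hb, haS, h⟩ := hpin2
                rw [h F θ hP g₀ os]
                exact n15At_fullGSizedObjects_family hb haS ν μ α β' c35 p F
              · show N16HolderAt (rateCarriersOfRecord₁₃CoPH 𝔯 F θ hP g₀ os (ksel F θ hP g₀ os)).ne3 β
                rw [rateCarriers_ne3_of_pinnedLoose hpinL F θ hP g₀ os (ksel F θ hP g₀ os)]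
                exact h16 F ⟨θ, hP, hRg.1, hθ⟩)
            (fun F θ hP hRg hθ => hs F θ hP hRg.1 hθ) (fun F θ hP hRg hθ => hκ F θ hP hRg.1 hθ) (fun F θ hP hRg hθ => hcr F θ hP hRg.1 hθ)
            (fun F θ hP hRg hθ => hρ F θ hP hRg.1 hθ) (h20_shape_crOneTerm₁₃ K₀) (h21_shape_crOneTerm₁₃ K₀)
            (fun F θ hP hRg hθ => (htarget F θ hP hRg hθ).mono fun g₀ hg os hPr =>
              (core_crOneTerm₁₃_iff_target K₀ θ hP g₀ os).2 (hg os hPr))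
            (fun _ θ hP _ _ => ForSmallCouplings.of_forall fun g₀ os => extraction_crOneTerm₁₃ K₀ θ hP g₀ os)
            (fun F θ hP hRg hθ => hK 0 1 F θ hP hRg.1 hθ) (fun F θ hP hRg hθ => h18' F θ hP hRg.1 hθ)
            (fun F θ hP hRg hθ => h22' F θ hP hRg.1 hθ))
          F θ h.toCore hG hθ) _

end Summit.QuantumFields.YangMills.Theorems.BalabanUVNodesN27SpineRecord
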